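import Literature.NumberTheory.Automorphic.ResGLnCohomology
import Literature.NumberTheory.Automorphic.ParallelWeightAdelicCoefficients
import HarnessLib

/-!
# The coefficients `E_λ = ⨂_τ V_{λ_τ}` of `Res_{K/ℚ} GL_n` as a representation of `GL_n(𝔸_K^∞)`
# through the `p`-adic places (arbitrary — non-parallel — weight `λ = (λ_τ)_τ`)

Topic `NumberTheory/Automorphic`; namespace `Literature.NumberTheory.Automorphic.ResGLnCohomology`
(the grouping namespace of the coefficient modules `E_λ(k) = ResGLnCohomology.CoeffModule k n K λ`).
Definitions with bodies and theorems; no named fact, no instance, no `sorry`.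

`ParallelWeightAdelicCoefficients` extends the PARALLEL-weight coefficient representation
`⨂_{τ : F → E} V_wt(E) ∘ GL_n(τ)` of `GL_n(F)` to the finite-adelic group through place data
`(v, φ)`.  The algebraic local systems of [Scholze2015, §V.4] ("an algebraic representation `ξ` of
`Res_{F/ℚ} GL_n` with coefficients in `ℚ̄_p` … defines a local system `ℳ_{ξ,K}` on `X_K`",
arXiv:1306.2070, p. 66) and the coefficient systems `E_μ = ⊗_v E_{μ_v}` of Clozel / Grobner–Raghuram
have one weight `λ_τ` PER EMBEDDING `τ`; this file carries out the same (one-screen) construction for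
the tree's general coefficient module `E_λ(k) = ⨂_{τ : K → k} V_{λ_τ}(k)`
(`ResGLnCohomology.CoeffModule`, representation `ResGLnCohomology.coeffRep`):

* `adelicCoeffRep k n K λ v φ` — for place data `v : (K →+* k) → {finite places}`,
  `φ τ : K_{v τ} →+* k`, the representation `g ↦ ⨂_τ V_{λ_τ}(GL_n(φ_τ)(g_{v(τ)}))` of
  `GL_n(𝔸_K^∞)` on `E_λ(k)`; `adelicCoeffRep_comp_globalEmbedding`: **it restricts to
  `ResGLnCohomology.coeffRep` on `GL_n(K)`** when `φ_τ ∘ (K → K_{v τ}) = τ`;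
  `adelicCoeffRep_eq_of_localComponent_eq`: it sees only the components at the places `v τ`;
* over `k = ℚ̄_p`, with the place data `padicPlace`, `padicPlaceHom` of
  `ParallelWeightAdelicCoefficients` (every `τ : K → ℚ̄_p` cuts out a place `v(τ) ∣ p` and extends
  continuously to `K_{v(τ)}`, Neukirch II §8): **`padicCoeffRep n K p λ`**, with
  `padicCoeffRep_comp_globalEmbedding : padicCoeffRep ∘ ι = coeffRep ℚ̄_p n K λ`
  (`ι = globalEmbedding`), `padicCoeffRep_eq_one_of_localComponent_eq_one` (elements trivial above
  `p` — e.g. the Hecke elements `t_{w,j}`, `w ∤ p`, and the prime-to-`p` part of the level — act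
  trivially), and the form `padicCoeffRep_comp_globalEmbedding_eq` for a representation `ρ` GIVEN
  by the defining formula of `coeffRep` on the bare tensor product (the shape of the hypothesis
  `ρ = PiTensorProduct.mapMonoidHom.comp …` of `algebraicWeightEigenclass_continuousPoint`);
* `cohomologyIsoPadic` / `cohomologyIsoPadic_hom_heckeEnd` — the identity-on-functions,
  Hecke-equivariant isomorphism `H^q(X_U, Ẽ_λ)_{padicCoeffRep ∘ ι} ≅ H^q(X_U, Ẽ_λ)_ρ` of twisted
  cohomology groups (`TwistedQuotient.cohomologyIsoOfEq`), so that constructions made with the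
  finite-adelic action (integral structures `ℳ_{ξ,K}`, change of level at `p`) land in the
  cohomology of such a `ρ` literally.

## References

* P. Scholze, *On torsion in the cohomology of locally symmetric varieties*, Ann. of Math. 182
  (2015), §V.4 (arXiv:1306.2070, p. 66: the local system `ℳ_{ξ,K}`). [Scholze2015]
* H. Grobner, A. Raghuram, *On the arithmetic of Shalika models…*, Amer. J. Math. 136 (2014), §7.1
  (`E_μ = ⊗_v E_{μ_v}`). [GrobnerRaghuram2014]
* H. Hida, *p-adic ordinary Hecke algebras for GL(2)*, Ann. Inst. Fourier 44 (1994), §1 (the action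
  `(g, P) ↦ (g, g_p P)`). [Hida1994AIF]
* J. Neukirch, *Algebraic Number Theory* (1999), Ch. II §8 (pp. 160–161). [NeukirchANT1999]
-/

noncomputable section

open CategoryTheory
open scoped NumberField TensorProduct
open IsDedekindDomain

namespace Literature.NumberTheory.Automorphic

namespace ResGLnCohomology

open BigHeckeGLn GLnCohomology

/-! ### `E_λ(k)` as a representation of `GL_n(𝔸_K^∞)` attached to place data -/

section PlaceData

variable (k : Type) [Field k] (n : ℕ) (K : Type) [Field K] [NumberField K]
  (lam : (K →+* k) → Fin n → ℤ)
  (v : (K →+* k) → HeightOneSpectrum (𝓞 K))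
  (φ : ∀ τ : K →+* k, (v τ).adicCompletion K →+* k)

/-- **`E_λ(k) = ⨂_τ V_{λ_τ}(k)` as a representation of `GL_n(𝔸_K^∞)`** attached to place data
`(v, φ)`: `g ↦ ⨂_τ V_{λ_τ}(GL_n(φ_τ)(g_{v(τ)}))` — the finite-adelic group acts on the factor of
the embedding `τ` through its component at the place `v(τ)` (above `p`, for `k = ℚ̄_p`), mapped to
`GL_n(k)` along `φ_τ` and then through the algebraic representation `V_{λ_τ} = coeffRepGL k n (λ τ)`.
This is the action through `GL_n(K ⊗ ℚ_p) = ∏_{w ∣ p} GL_n(K_w)` by which an algebraic representation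
of `Res_{K/ℚ} GL_n` over `ℚ̄_p` defines the local system `ℳ_{ξ,K}` [cite: Scholze2015, §V.4 (p. 66)];
Hida's "`(g, P) ↦ (g, g_p P)`" [cite: Hida1994AIF, §1]. -/
def adelicCoeffRep : Representation k (FiniteAdelicGL n K) (CoeffModule k n K lam) :=
  show Representation k (FiniteAdelicGL n K)
      (⨂[k] τ : (K →+* k), GLnCohomology.CoeffModule k n (lam τ)) from
    PiTensorProduct.mapMonoidHom.comp
      (MonoidHom.pi fun τ : K →+* k =>
        (coeffRepGL k n (lam τ)).comp
          ((Matrix.GeneralLinearGroup.map (φ τ)).comp (localComponent n K (v τ))))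

/-- Unfolding lemma on pure tensors: `σ(g)(⨂_τ w_τ) = ⨂_τ V_{λ_τ}(GL_n(φ_τ) g_{v τ}) w_τ`.
[folklore] -/
@[simp]
theorem adelicCoeffRep_apply_tprod (g : FiniteAdelicGL n K)
    (w : ∀ τ : K →+* k, GLnCohomology.CoeffModule k n (lam τ)) :
    adelicCoeffRep k n K lam v φ g (CoeffModule.tprod w) =
      CoeffModule.tprod fun τ =>
        coeffRepGL k n (lam τ)
          (Matrix.GeneralLinearGroup.map (φ τ) (localComponent n K (v τ) g)) (w τ) :=
  PiTensorProduct.map_tprod _ _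

/-- Unfolding lemma: `adelicCoeffRep … g` is `PiTensorProduct.map` of the factor actions.
[folklore] -/
theorem adelicCoeffRep_apply (g : FiniteAdelicGL n K) :
    adelicCoeffRep k n K lam v φ g =
      PiTensorProduct.map (R := k) fun τ : K →+* k =>
        (coeffRepGL k n (lam τ)
            (Matrix.GeneralLinearGroup.map (φ τ) (localComponent n K (v τ) g)) :
          GLnCohomology.CoeffModule k n (lam τ) →ₗ[k] GLnCohomology.CoeffModule k n (lam τ)) :=
  rfl

/-- The action depends only on the components at the places `v τ`. [folklore] -/
theorem adelicCoeffRep_eq_of_localComponent_eq {g g' : FiniteAdelicGL n K}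
    (h : ∀ τ, localComponent n K (v τ) g = localComponent n K (v τ) g') :
    adelicCoeffRep k n K lam v φ g = adelicCoeffRep k n K lam v φ g' := by
  rw [adelicCoeffRep_apply, adelicCoeffRep_apply]
  congr 1
  funext τ
  rw [h τ]

/-- **`adelicCoeffRep` restricts to `ResGLnCohomology.coeffRep` on `GL_n(K)`** (for place data
with `φ_τ ∘ (K → K_{v τ}) = τ`): the finite-adelic action extends the rational one, since the
`v`-component of a principal element `γ` is `γ` mapped along `K → K_v`
(`ParallelWeight.map_localComponent_globalEmbedding`). [cite: Hida1994AIF, §1] -/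
theorem adelicCoeffRep_comp_globalEmbedding
    (hφ : ∀ (τ : K →+* k) (x : K), φ τ (algebraMap K ((v τ).adicCompletion K) x) = τ x) :
    (adelicCoeffRep k n K lam v φ).comp (globalEmbedding n K) = coeffRep k n K lam := by
  refine MonoidHom.ext fun γ => ?_
  rw [MonoidHom.comp_apply, adelicCoeffRep_apply, coeffRep_apply]
  congr 1
  funext τ
  rw [ParallelWeight.map_localComponent_globalEmbedding hφ τ γ]

/-- Pointwise form: `σ(ι γ) = coeffRep γ`. [folklore] -/
theorem adelicCoeffRep_globalEmbedding
    (hφ : ∀ (τ : K →+* k) (x : K), φ τ (algebraMap K ((v τ).adicCompletion K) x) = τ x)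
    (γ : GL (Fin n) K) :
    adelicCoeffRep k n K lam v φ (globalEmbedding n K γ) = coeffRep k n K lam γ := by
  rw [← adelicCoeffRep_comp_globalEmbedding k n K lam v φ hφ, MonoidHom.comp_apply]

end PlaceData

/-! ### Over `ℚ̄_p`: the action through the `p`-adic places -/

section Padic

variable (n : ℕ) (K : Type) [Field K] [NumberField K] (p : ℕ) [Fact p.Prime]
  (lam : (K →+* PadicAlgCl p) → Fin n → ℤ)

/-- **`E_λ(ℚ̄_p) = ⨂_{τ : K → ℚ̄_p} V_{λ_τ}(ℚ̄_p)` as a representation of `GL_n(𝔸_K^∞)` through the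
`p`-adic places**, `g ↦ ⨂_τ V_{λ_τ}(GL_n(φ_τ)(g_{v(τ)}))` for the chosen place data
`padicPlace K p τ ∣ p`, `padicPlaceHom K p τ : K_{v(τ)} → ℚ̄_p` (continuous, extending `τ`) of
`ParallelWeightAdelicCoefficients`. [cite: Scholze2015, §V.4 (p. 66)] [cite: Hida1994AIF, §1] -/
def padicCoeffRep :
    Representation (PadicAlgCl p) (FiniteAdelicGL n K) (CoeffModule (PadicAlgCl p) n K lam) :=
  adelicCoeffRep (PadicAlgCl p) n K lam (ParallelWeight.padicPlace K p)
    (ParallelWeight.padicPlaceHom K p)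

/-- **`padicCoeffRep ∘ ι = coeffRep`** on `GL_n(K)` (`ι = globalEmbedding`).
[cite: Scholze2015, §V.4 (p. 66)] -/
theorem padicCoeffRep_comp_globalEmbedding :
    (padicCoeffRep n K p lam).comp (globalEmbedding n K) = coeffRep (PadicAlgCl p) n K lam :=
  adelicCoeffRep_comp_globalEmbedding _ n K lam _ _ (ParallelWeight.padicPlaceHom_algebraMap K p)

/-- Pointwise form: `padicCoeffRep (ι γ) = coeffRep γ`. [folklore] -/
theorem padicCoeffRep_globalEmbedding (γ : GL (Fin n) K) :
    padicCoeffRep n K p lam (globalEmbedding n K γ) = coeffRep (PadicAlgCl p) n K lam γ :=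
  adelicCoeffRep_globalEmbedding _ n K lam _ _ (ParallelWeight.padicPlaceHom_algebraMap K p) γ

/-- `padicCoeffRep g` depends only on the components of `g` at the `p`-adic places `v(τ)`.
[folklore] -/
theorem padicCoeffRep_eq_of_localComponent_eq {g g' : FiniteAdelicGL n K}
    (h : ∀ τ, localComponent n K (ParallelWeight.padicPlace K p τ) g =
      localComponent n K (ParallelWeight.padicPlace K p τ) g') :
    padicCoeffRep n K p lam g = padicCoeffRep n K p lam g' :=
  adelicCoeffRep_eq_of_localComponent_eq _ n K lam _ _ h

/-- Elements with trivial components at all places above `p` (e.g. `t_{w,j}` for `w ∤ p`) act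
trivially. [folklore] -/
theorem padicCoeffRep_eq_one_of_localComponent_eq_one {g : FiniteAdelicGL n K}
    (h : ∀ w : HeightOneSpectrum (𝓞 K), ((p : ℕ) : 𝓞 K) ∈ w.asIdeal →
      localComponent n K w g = 1) :
    padicCoeffRep n K p lam g = 1 := by
  rw [← map_one (padicCoeffRep n K p lam)]
  exact padicCoeffRep_eq_of_localComponent_eq n K p lam fun τ => by
    rw [h _ (ParallelWeight.natCast_mem_padicPlace K p τ), map_one]

/-- Elements agreeing at all places above `p` act identically. [folklore] -/
theorem padicCoeffRep_eq_of_forall_mem {g g' : FiniteAdelicGL n K}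
    (h : ∀ w : HeightOneSpectrum (𝓞 K), ((p : ℕ) : 𝓞 K) ∈ w.asIdeal →
      localComponent n K w g = localComponent n K w g') :
    padicCoeffRep n K p lam g = padicCoeffRep n K p lam g' :=
  padicCoeffRep_eq_of_localComponent_eq n K p lam fun τ =>
    h _ (ParallelWeight.natCast_mem_padicPlace K p τ)

/-- **The form used with a representation given by the defining formula.**  If a representation
`ρ` of `GL_n(K)` on the bare tensor product `⨂_τ V_{λ_τ}(ℚ̄_p)` is (propositionally) the formula
`g ↦ ⨂_τ V_{λ_τ}(τ g)` — the hypothesis `ρ = PiTensorProduct.mapMonoidHom.comp …` of the tree's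
`algebraicWeightEigenclass_continuousPoint` — then `ρ = padicCoeffRep ∘ ι`: `ρ` extends to the
finite-adelic group through the `p`-adic places. [cite: Scholze2015, §V.4 (p. 66)] -/
theorem padicCoeffRep_comp_globalEmbedding_eq
    {ρ : Representation (PadicAlgCl p) (GL (Fin n) K)
      (⨂[PadicAlgCl p] τ : (K →+* PadicAlgCl p), GLnCohomology.CoeffModule (PadicAlgCl p) n (lam τ))}
    (hρ : ρ = PiTensorProduct.mapMonoidHom.comp (MonoidHom.pi fun τ : K →+* PadicAlgCl p =>
      (coeffRepGL (PadicAlgCl p) n (lam τ)).comp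
        (Matrix.GeneralLinearGroup.map (τ : K →+* PadicAlgCl p)))) :
    (padicCoeffRep n K p lam).comp (globalEmbedding n K) = ρ := by
  rw [padicCoeffRep_comp_globalEmbedding, hρ]
  rfl

/-! ### The cohomology of such a `ρ` is the cohomology of `padicCoeffRep ∘ ι` -/

/-- **`H^q(X_U, Ẽ_λ)` for `ρ` given by the formula is the twisted cohomology of `padicCoeffRep ∘ ι`**,
by the identity-on-functions isomorphism `TwistedQuotient.cohomologyIsoOfEq` along
`padicCoeffRep_comp_globalEmbedding_eq`. [folklore] -/
def cohomologyIsoPadic (U : Subgroup (FiniteAdelicGL n K))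
    {ρ : Representation (PadicAlgCl p) (GL (Fin n) K)
      (⨂[PadicAlgCl p] τ : (K →+* PadicAlgCl p), GLnCohomology.CoeffModule (PadicAlgCl p) n (lam τ))}
    (hρ : ρ = PiTensorProduct.mapMonoidHom.comp (MonoidHom.pi fun τ : K →+* PadicAlgCl p =>
      (coeffRepGL (PadicAlgCl p) n (lam τ)).comp
        (Matrix.GeneralLinearGroup.map (τ : K →+* PadicAlgCl p))))
    (q : ℕ) :
    TwistedQuotient.cohomology (globalEmbedding n K) U
        ((padicCoeffRep n K p lam).comp (globalEmbedding n K)) q ≅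
      TwistedQuotient.cohomology (globalEmbedding n K) U ρ q :=
  TwistedQuotient.cohomologyIsoOfEq (globalEmbedding n K) U
    (padicCoeffRep_comp_globalEmbedding_eq n K p lam hρ) q

/-- Hecke-equivariance of `cohomologyIsoPadic`: `Φ (T_g x) = T_g (Φ x)` for every
`g ∈ GL_n(𝔸_K^∞)` (`T_g = TwistedQuotient.heckeEnd`). [folklore] -/
theorem cohomologyIsoPadic_hom_heckeEnd (U : Subgroup (FiniteAdelicGL n K))
    {ρ : Representation (PadicAlgCl p) (GL (Fin n) K)
      (⨂[PadicAlgCl p] τ : (K →+* PadicAlgCl p), GLnCohomology.CoeffModule (PadicAlgCl p) n (lam τ))}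
    (hρ : ρ = PiTensorProduct.mapMonoidHom.comp (MonoidHom.pi fun τ : K →+* PadicAlgCl p =>
      (coeffRepGL (PadicAlgCl p) n (lam τ)).comp
        (Matrix.GeneralLinearGroup.map (τ : K →+* PadicAlgCl p))))
    (q : ℕ) (g : FiniteAdelicGL n K)
    (x : TwistedQuotient.cohomology (globalEmbedding n K) U
      ((padicCoeffRep n K p lam).comp (globalEmbedding n K)) q) :
    (cohomologyIsoPadic n K p lam U hρ q).hom.hom
        (TwistedQuotient.heckeEnd (globalEmbedding n K) U
          ((padicCoeffRep n K p lam).comp (globalEmbedding n K)) g q x) =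
      TwistedQuotient.heckeEnd (globalEmbedding n K) U ρ g q
        ((cohomologyIsoPadic n K p lam U hρ q).hom.hom x) :=
  TwistedQuotient.cohomologyIsoOfEq_hom_heckeEnd (globalEmbedding n K) U
    (padicCoeffRep_comp_globalEmbedding_eq n K p lam hρ) g q x

/-- The inverse direction: `Φ⁻¹ (T_g y) = T_g (Φ⁻¹ y)`. [folklore] -/
theorem cohomologyIsoPadic_inv_heckeEnd (U : Subgroup (FiniteAdelicGL n K))
    {ρ : Representation (PadicAlgCl p) (GL (Fin n) K)
      (⨂[PadicAlgCl p] τ : (K →+* PadicAlgCl p), GLnCohomology.CoeffModule (PadicAlgCl p) n (lam τ))}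
    (hρ : ρ = PiTensorProduct.mapMonoidHom.comp (MonoidHom.pi fun τ : K →+* PadicAlgCl p =>
      (coeffRepGL (PadicAlgCl p) n (lam τ)).comp
        (Matrix.GeneralLinearGroup.map (τ : K →+* PadicAlgCl p))))
    (q : ℕ) (g : FiniteAdelicGL n K)
    (y : TwistedQuotient.cohomology (globalEmbedding n K) U ρ q) :
    (cohomologyIsoPadic n K p lam U hρ q).inv.hom
        (TwistedQuotient.heckeEnd (globalEmbedding n K) U ρ g q y) =
      TwistedQuotient.heckeEnd (globalEmbedding n K) U
        ((padicCoeffRep n K p lam).comp (globalEmbedding n K)) g q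
        ((cohomologyIsoPadic n K p lam U hρ q).inv.hom y) := by
  set Φ := cohomologyIsoPadic n K p lam U hρ q with hΦ
  have hy : y = Φ.hom.hom (Φ.inv.hom y) := by
    rw [← ModuleCat.comp_apply]
    change y = (Φ.inv ≫ Φ.hom).hom y
    rw [Φ.inv_hom_id]
    rfl
  conv_lhs => rw [hy, ← cohomologyIsoPadic_hom_heckeEnd n K p lam U hρ q g]
  rw [← ModuleCat.comp_apply]
  change (Φ.hom ≫ Φ.inv).hom _ = _
  rw [Φ.hom_inv_id]
  rfl

/-- Transport of non-vanishing along `cohomologyIsoPadic⁻¹`. [folklore] -/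
theorem cohomologyIsoPadic_inv_apply_ne_zero (U : Subgroup (FiniteAdelicGL n K))
    {ρ : Representation (PadicAlgCl p) (GL (Fin n) K)
      (⨂[PadicAlgCl p] τ : (K →+* PadicAlgCl p), GLnCohomology.CoeffModule (PadicAlgCl p) n (lam τ))}
    (hρ : ρ = PiTensorProduct.mapMonoidHom.comp (MonoidHom.pi fun τ : K →+* PadicAlgCl p =>
      (coeffRepGL (PadicAlgCl p) n (lam τ)).comp
        (Matrix.GeneralLinearGroup.map (τ : K →+* PadicAlgCl p))))
    (q : ℕ) {y : TwistedQuotient.cohomology (globalEmbedding n K) U ρ q} (hy : y ≠ 0) :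
    (cohomologyIsoPadic n K p lam U hρ q).inv.hom y ≠ 0 := by
  intro h
  apply hy
  have : y = (cohomologyIsoPadic n K p lam U hρ q).hom.hom
      ((cohomologyIsoPadic n K p lam U hρ q).inv.hom y) := by
    rw [← ModuleCat.comp_apply]
    change y = ((cohomologyIsoPadic n K p lam U hρ q).inv ≫
      (cohomologyIsoPadic n K p lam U hρ q).hom).hom y
    rw [Iso.inv_hom_id]
    rfl
  rw [this, h, map_zero]

end Padic

end ResGLnCohomology

end Literature.NumberTheory.Automorphic
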